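import Summits.CriticalPhenomena.PercolationContinuityZ3.Theorems.Transplant.SkelPhiFaceRegionN
import Summits.CriticalPhenomena.PercolationContinuityZ3.Theorems.Transplant.SkelPhiCellsWeakGLevels
import Summits.CriticalPhenomena.PercolationContinuityZ3.Theorems.Transplant.SkelPhiConcFaceStep
import HarnessLib

/-!
# N1 ({±1} node), (F) part 2 (hp-8 g33): the LAW of the face step over the fine-cell scheme `Skelφ.cellGeomSG₂ G ψ P w₀ Λ` is a subbox
# weighting of the window graph on EVERY SUB-REGION `Dd ⊆ Win ψ w₀ (farAS₂ x du j) rE` of the cell-map face window; entrances into the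
# maximal fresh region are deep; the rim excess of a sub-region — twin of `SkelPhiConcFaceStep` §2–§3 (hp-8 g30) with
# `cellGeomSG ↦ cellGeomSG₂` (far region `EfarN₂`), `Steps ↦ WeakSteps` of the cell map, `farAS ↦ farAS₂`, and the region a PARAMETER
# (under p3-g8's ruling of 2026-08-21 14:33Z the face step's region is a window of the face's own frame map INSIDE the cell-map window)

builds on p205010 (kernel theorem, internal audit signed; external expert review pending) — nothing in this file uses p205010; nothing here is a
claim about the open node `SamePDropOfSkeletonNeg`.
Lane `prim-bschramm`, seat `prim-hp-8` (gen 33); helper file (`--supports stmt-CriticalPhenomena-4575 --as helper`).  Hypotheses: `hlip : Lip G ψ`,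
`hws : WeakSteps G ψ` of the CELL map `ψ` (e.g. `fineSkel`, p278428), `hΛ : WFS2 P Λ`; the planar map `φ` of the excess-radius clause (the genuine
skeleton map) is a separate slot, tied to the scheme only through the planar-diameter hypothesis `hdiam` on `E^far` (discharged from the inverse
reading `FinePrm.sub_mem_box_of_read` by the caller).  The Φ-free scheme lemmas (`Skel.isSubbox_Wt_win`, `KSchA.du_ne_rev₂`, `KSchA.root_not_mem_of_fresh`,
`Valid₂.sep_habitat`, `KSchA.Wt_eq_zero_of_not_mem_edgeSet`, `Skelφ.real_rim_le_of_radius`) are IMPORTED.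
* §1 `Efar₂_disjoint_Ewv'`, **`isSubbox_Wt_fresh₂ (hlip)`** (`Dd ⊆ E^far ∖ Stub_j`, depth `≥ rE, rQ_a(x)`), **`isSubbox_Wt_sub₂ (hlip) (hws)`**
  (`Dd ⊆ Win (farAS₂) rE`, depth `rE`), `sub_subset_Sx₂`, `root_not_mem_sub₂`;
* §2 **`entrance_faceFresh₂ (hlip)`** (depth `≤ R₀ + 1`), **`rim_excess_sub₂ (hlip) (hws)`** (`P_{Wt}(⋃_{t ∈ Dd, d(w₀,t) > Rt − L'} w₀ ↔ t) ≤ η` from an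
  excess radius `R₁ ≤ Rt − L'` for the planar map `φ` at entrance depth `R₀ + 1` and planar diameter `m` of `E^far`).
[cite: KozmaNitzan2024, §4 p. 27 ((30)), p. 30 (Step III), p. 31 (D is a subbox of Ω), Lemma 12 (p. 24)] [cite: MartineauSevero2019, Cor. 2.2]
-/

noncomputable section

open MeasureTheory
open scoped Classical

namespace Summit.CriticalPhenomena.PercolationContinuityZ3.Theorems.Transplant

namespace Skelφ

open Literature.Probability.Percolation Literature.Probability.LatticeModels SimpleGraph KNCells KNLevels GadgetSystem Contour
open Literature.Probability.Percolation.KozmaNitzan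
open Literature.Probability.Percolation.KozmaNitzan.Cells (oth oth_ne sgOf sgOf_sign stepVec_apply_fst stepVec_apply_oth eq_oth_of_ne oth_oth)
open Literature.Barriers.CriticalPhenomena (graphBall graphBall_finite mem_graphBall_self graphBall_mono)
open BoxProdZ2 (ConcRadiiG mem_graphBall_succ_of_adj)
open Skel (winGraph excess)

variable {V : Type} [DecidableEq V] {G : SimpleGraph V} [G.LocallyFinite] {ψ : V → Site 2}
variable {P : PCells2} {w₀ : V} {Λ : ConcRadiiG} {S : KSchA V ℕ}
variable (hΓ : S.Γ = cellGeomSG₂ G ψ P w₀ Λ) (hΛ : WFS2 P Λ)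
variable {h : ProbeHistory V} {e : Site 2 × MDir} (hV : S.Valid₂ G h e) {a a' : ℕ} {du : MDir} (hdu : du ∈ S.onward G h (tgt e))
variable {j : ℕ} {o : Finset (Sym2 V)}

/-! ## §1 The subbox facts of the face step, for every sub-region of the cell-map window -/

/-- `E^far_{a'}(w + δw, du)` (slack far region) misses `E_{w,v}` of the incoming edge when `du` is not the way back. [cite: KozmaNitzan2024, §4 p. 26] -/
theorem Efar₂_disjoint_Ewv' (a a' : ℕ) (w : Site 2) {δw du : MDir} (hne : du ≠ rev δw) :
    Disjoint ((cellGeomSG₂ G ψ P w₀ Λ).Efar a' (w + stepVec δw) du) ((cellGeomSG₂ G ψ P w₀ Λ).Ewv a w δw) := by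
  have h := P.EwvN_disjoint_EfarN w hne
  rw [PCells2.EwvN, Finset.disjoint_union_left] at h
  have hsub : P.EfarN₂ (w + stepVec δw) du ⊆ P.EfarN (w + stepVec δw) du := P.EfarN₂_subset_EfarN _ du
  change Disjoint (VWin G ψ w₀ (P.EfarN₂ (w + stepVec δw) du) (Λ.rE a' (w + stepVec δw) du))
    (VWin G ψ w₀ (P.BtwN w δw) (Λ.rB a w δw) ∪ VWin G ψ w₀ (P.Q (w + stepVec δw)) (Λ.rQ a (w + stepVec δw)))
  rw [Finset.disjoint_union_right]
  exact ⟨disjoint_VWin (h.1.symm.mono_left hsub) _ _, disjoint_VWin (h.2.symm.mono_left hsub) _ _⟩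

include hΓ hΛ hV hdu

/-- **Every `Dd ⊆ E^far_{a'}(x, du)` missing `Stub_j` is a subbox of `Wt` in the window graph of any depth `R ≥ rE_{a'}(x,du), rQ_a(x)`**
(from `Lip` of the cell map). [cite: KozmaNitzan2024, §4 p. 31 (D is a subbox of Ω)] -/
theorem isSubbox_Wt_fresh₂ (hlip : Lip G ψ) {R : ℕ} (hE : Λ.rE a' (tgt e) du ≤ R) (hQ : Λ.rQ a (tgt e) ≤ R) {Dd : Finset V}
    (hDd : Dd ⊆ S.Γ.Efar a' (tgt e) du) (hdS : Disjoint Dd (S.Γ.Stub a' (tgt e) du j)) :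
    KNLevels.IsSubbox (winGraph G w₀ R) (S.Wt G h e a a' du j o) S.p Dd := by
  obtain ⟨Γ, p, δc⟩ := S
  cases hΓ
  have hne : du ≠ rev e.2 := KSchA.du_ne_rev₂ hV hdu
  have hL := levelGeomSG₂ P w₀ hΛ hlip
  refine Skel.isSubbox_Wt_win G w₀ R hL (qSepGeomSG₂ P w₀ hlip) hV hdu (b := a) (hDd.trans Finset.subset_union_right)
    (fun u hu => by unfold KSchA.Sx; exact Finset.mem_union_right _ (hDd hu)) ?_ ?_ ?_
  · exact Finset.disjoint_union_right.2 ⟨(Efar₂_disjoint_Ewv' a a' e.1 hne).mono_left hDd, hdS⟩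
  · intro u hu
    have hu' : u ∈ VWin G ψ w₀ (P.EfarN₂ (tgt e) du) (Λ.rE a' (tgt e) du) := hDd hu
    exact graphBall_mono G w₀ hE (mem_graphBall_of_mem_VWin hu')
  · intro v hv x hx hadj
    rcases Finset.mem_union.1 hx with hx | hx
    · rw [CellGeom.Ewv] at hx
      rcases Finset.mem_union.1 hx with hx | hx
      · exact absurd hadj (hL.Btw_sep_Efar a a' e.1 e.2 du hne x hx v (hDd hv)).2
      · have hx' : x ∈ VWin G ψ w₀ (P.Q (e.1 + stepVec e.2)) (Λ.rQ a (e.1 + stepVec e.2)) := hx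
        exact graphBall_mono G w₀ hQ (mem_graphBall_of_mem_VWin hx')
    · have hx' : x ∈ VWin G ψ w₀ (P.EfarN₂ (tgt e) du) (Λ.rE a' (tgt e) du) := hx
      exact graphBall_mono G w₀ hE (mem_graphBall_of_mem_VWin hx')

/-- **Every sub-region `Dd` of the cell-map face window `Win w₀ (farAS₂ x du j) rE` is a subbox of `Wt` in the window graph of depth `rE`** — no
hypothesis on `rB`, `rQ`: nothing of `E_{w,v}` is `G`-adjacent to the window (from `Lip` and the weak steps of the cell map).
[cite: KozmaNitzan2024, §4 p. 31, p. 30 (Step III)] -/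
theorem isSubbox_Wt_sub₂ (hlip : Lip G ψ) (hws : WeakSteps G ψ) {Dd : Finset V}
    (hDd : Dd ⊆ Win G ψ w₀ (P.farAS₂ (tgt e) du j) (Λ.rE a' (tgt e) du)) :
    KNLevels.IsSubbox (winGraph G w₀ (Λ.rE a' (tgt e) du)) (S.Wt G h e a a' du j o) S.p Dd := by
  obtain ⟨Γ, p, δc⟩ := S
  cases hΓ
  have hne : du ≠ rev e.2 := KSchA.du_ne_rev₂ hV hdu
  have hL := levelGeomSG₂ P w₀ hΛ hlip
  have hW : Win G ψ w₀ (P.farAS₂ (tgt e) du j) (Λ.rE a' (tgt e) du) ⊆ (cellGeomSG₂ G ψ P w₀ Λ).Efar a' (tgt e) du :=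
    Win_farAS₂_subset_Efar P w₀ hlip hws (le_trans (by omega) (hΛ.ρE1 a' (tgt e) du 0)) j
  have hDd' := hDd.trans hW
  refine Skel.isSubbox_Wt_win G w₀ _ hL (qSepGeomSG₂ P w₀ hlip) hV hdu (b := a) (hDd'.trans Finset.subset_union_right)
    (fun u hu => by unfold KSchA.Sx; exact Finset.mem_union_right _ (hDd' hu)) ?_ (fun u hu => ((mem_Win G ψ).1 (hDd hu)).1) ?_
  · exact Finset.disjoint_union_right.2
      ⟨(disjoint_Win_farAS₂_Ewv P w₀ a e.1 hne j _).mono_left hDd, (disjoint_Win_farAS₂_Stub P w₀ a' (tgt e) du j _).mono_left hDd⟩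
  · intro v hv x hx hadj
    rcases Finset.mem_union.1 hx with hx | hx
    · rw [CellGeom.Ewv] at hx
      rcases Finset.mem_union.1 hx with hx | hx
      · exact absurd hadj (hL.Btw_sep_Efar a a' e.1 e.2 du hne x hx v (hDd' hv)).2
      · exact absurd hadj (sep_Q_Win_farAS₂ P w₀ hlip a (tgt e) du j _ x hx v (hDd hv)).2
    · have hx' : x ∈ VWin G ψ w₀ (P.EfarN₂ (tgt e) du) (Λ.rE a' (tgt e) du) := hx
      exact mem_graphBall_of_mem_VWin hx'

omit hV hdu in
/-- A sub-region of the cell-map face window lies in the support `Sx = E_i ∪ E_{w,v} ∪ E^far` of `Wt` (from `Lip`, weak steps). [folklore] -/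
theorem sub_subset_Sx₂ (hlip : Lip G ψ) (hws : WeakSteps G ψ) {Dd : Finset V}
    (hDd : Dd ⊆ Win G ψ w₀ (P.farAS₂ (tgt e) du j) (Λ.rE a' (tgt e) du)) : Dd ⊆ S.Sx G h e a a' du := by
  obtain ⟨Γ, p, δc⟩ := S
  cases hΓ
  intro u hu
  unfold KSchA.Sx
  exact Finset.mem_union_right _ (Win_farAS₂_subset_Efar P w₀ hlip hws (le_trans (by omega) (hΛ.ρE1 a' (tgt e) du 0)) j (hDd hu))

/-- The root lies off every sub-region of the cell-map face window (it is explored; the window is fresh). [folklore] -/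
theorem root_not_mem_sub₂ (hlip : Lip G ψ) (hws : WeakSteps G ψ) {Dd : Finset V}
    (hDd : Dd ⊆ Win G ψ w₀ (P.farAS₂ (tgt e) du j) (Λ.rE a' (tgt e) du)) : S.Γ.root ∉ Dd := by
  obtain ⟨Γ, p, δc⟩ := S
  cases hΓ
  exact KSchA.root_not_mem_of_fresh (levelGeomSG₂ P w₀ hΛ hlip) (qSepGeomSG₂ P w₀ hlip) hV hdu (a := a')
    ((hDd.trans (Win_farAS₂_subset_Efar P w₀ hlip hws (le_trans (by omega) (hΛ.ρE1 a' (tgt e) du 0)) j)).trans Finset.subset_union_right)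

/-! ## §2 Entrances into the maximal fresh region are deep; the rim excess of a sub-region -/

/-- **Entrances into `E^far ∖ Stub_j` are deep** (slack far region): a positive-weight edge of `Wt` from outside `E^far_{a'}(x,du) ∖ Stub_j` into it
starts in the cube span `Q_a(x)` or in the stub span, so it lands at depth `≤ R₀ + 1` once `R₀ ≥ rQ_a(x)` and `R₀ ≥ sup ρ_{a'}(x, du, ·)` (from `Lip`).
[cite: KozmaNitzan2024, §4 pp. 26, 31] -/
theorem entrance_faceFresh₂ (hlip : Lip G ψ) {R₀ : ℕ} (hQ : Λ.rQ a (tgt e) ≤ R₀) (hρ : ∀ ℓ, Λ.ρ a' (tgt e) du ℓ ≤ R₀) {y b : V}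
    (hy : y ∉ S.Γ.Efar a' (tgt e) du \ S.Γ.Stub a' (tgt e) du j) (hb : b ∈ S.Γ.Efar a' (tgt e) du \ S.Γ.Stub a' (tgt e) du j)
    (hadj : G.Adj y b) (hw : S.Wt G h e a a' du j o s(y, b) ≠ 0) : b ∈ graphBall G w₀ (R₀ + 1) := by
  obtain ⟨Γ, p, δc⟩ := S
  cases hΓ
  have hne : du ≠ rev e.2 := KSchA.du_ne_rev₂ hV hdu
  have hL := levelGeomSG₂ P w₀ hΛ hlip
  have hbE : b ∈ (cellGeomSG₂ G ψ P w₀ Λ).Efar a' (tgt e) du := (Finset.mem_sdiff.1 hb).1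
  have hm : s(y, b) ∈ wireSet (↑(KSchA.Sx G ⟨cellGeomSG₂ G ψ P w₀ Λ, p, δc⟩ h e a a' du) : Set V) := by
    by_contra hm; exact hw (KSchA.Wt_apply_of_not_mem_wireSet hm)
  have hyS : y ∈ KSchA.Sx G ⟨cellGeomSG₂ G ψ P w₀ Λ, p, δc⟩ h e a a' du := Finset.mem_coe.1 (mk_mem_wireSet_iff.1 hm).1
  unfold KSchA.Sx at hyS
  rcases Finset.mem_union.1 hyS with hyS | hyE
  · rcases Finset.mem_union.1 hyS with hyV | hyW
    · exact absurd hadj (KSchA.Valid₂.sep_habitat hL (qSepGeomSG₂ P w₀ hlip) hV hdu (a := a) (a' := a') y hyV b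
        (Finset.mem_union_right _ hbE)).2
    · rw [CellGeom.Ewv] at hyW
      rcases Finset.mem_union.1 hyW with hyB | hyQ
      · exact absurd hadj (hL.Btw_sep_Efar a a' e.1 e.2 du hne y hyB b hbE).2
      · have hyQ' : y ∈ VWin G ψ w₀ (P.Q (e.1 + stepVec e.2)) (Λ.rQ a (e.1 + stepVec e.2)) := hyQ
        exact mem_graphBall_succ_of_adj G (graphBall_mono G w₀ hQ (mem_graphBall_of_mem_VWin hyQ')) hadj
  · have hySt : y ∈ (cellGeomSG₂ G ψ P w₀ Λ).Stub a' (tgt e) du j := by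
      by_contra h'; exact hy (Finset.mem_sdiff.2 ⟨hyE, h'⟩)
    have hySt' : y ∈ VStair G ψ w₀ (P.Stub (tgt e) du j) (prof P Λ a' (tgt e) du) := hySt
    exact mem_graphBall_succ_of_adj G (graphBall_mono G w₀ (hρ _) (mem_of_mem_VStair hySt').2) hadj

/-- **The rim excess of a sub-region `Dd` of the cell-map face window is `≤ η`.**  With `Rim = {v ∈ Dd : v ∉ B_G(w₀, Rt − L')}`, an entrance depth
`R₀ ≥ rQ_a(x), sup ρ_{a'}(x,du,·)`, an excess radius `R₁ ≤ Rt − L'` at the running parameter for the PLANAR MAP `φ` (centre `w₀`, entrance depth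
`R₀ + 1`, planar diameter `m`), and the planar diameter `m` of `E^far_{a'}(x,du)` under `φ`: `P_{Wt}(⋃_{t ∈ Rim} w₀ ↔ t) ≤ η`.  The habitat of the
excess event is the maximal fresh region `E^far ∖ Stub_j` (from `Lip` and the weak steps of the cell map `ψ`).
[cite: KozmaNitzan2024, §4 Lemma 12 (p. 24)] [cite: MartineauSevero2019, Cor. 2.2] -/
theorem rim_excess_sub₂ [Countable V] (hlip : Lip G ψ) (hws : WeakSteps G ψ) {R₀ : ℕ} (hQ : Λ.rQ a (tgt e) ≤ R₀)
    (hρ : ∀ ℓ, Λ.ρ a' (tgt e) du ℓ ≤ R₀) {φ : V → Site 2} {m Rt L' : ℕ} {η : ℝ} {R₁ : ℕ}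
    (hR₁ : ∀ R', R₁ ≤ R' → ∀ (Rw : ℕ) (D' A' : Finset V), (∀ d ∈ D', d ∈ graphBall G w₀ Rw) →
      (∀ d ∈ D', ∀ d' ∈ D', φ d - φ d' ∈ box 2 m) → A' ⊆ D' → (∀ a ∈ A', a ∈ graphBall G w₀ (R₀ + 1)) →
        (bondPercolation G S.p).real (excess G w₀ R' D' A') ≤ η)
    (hR : R₁ ≤ Rt - L') (hdiam : ∀ d ∈ S.Γ.Efar a' (tgt e) du, ∀ d' ∈ S.Γ.Efar a' (tgt e) du, φ d - φ d' ∈ box 2 m) {Dd : Finset V}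
    (hDd : Dd ⊆ Win G ψ w₀ (P.farAS₂ (tgt e) du j) (Λ.rE a' (tgt e) du)) :
    (prodBernoulli (S.Wt G h e a a' du j o)).real
      (⋃ t ∈ Dd.filter (fun v => v ∉ graphBall G w₀ (Rt - L')), openConn w₀ t) ≤ η := by
  have hdiam' := hdiam
  obtain ⟨Γ, p, δc⟩ := S
  cases hΓ
  set R := max (Λ.rE a' (tgt e) du) (Λ.rQ a (tgt e)) with hRdef
  set D : Finset V := (cellGeomSG₂ G ψ P w₀ Λ).Efar a' (tgt e) du \ (cellGeomSG₂ G ψ P w₀ Λ).Stub a' (tgt e) du j with hD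
  have hDE : D ⊆ (cellGeomSG₂ G ψ P w₀ Λ).Efar a' (tgt e) du := Finset.sdiff_subset
  have hDE' : D ⊆ VWin G ψ w₀ (P.EfarN₂ (tgt e) du) (Λ.rE a' (tgt e) du) := hDE
  have hWD := isSubbox_Wt_fresh₂ (S := ⟨cellGeomSG₂ G ψ P w₀ Λ, p, δc⟩) rfl hΛ hV hdu (j := j) (o := o) hlip
    (show Λ.rE a' (tgt e) du ≤ R from le_max_left _ _) (show Λ.rQ a (tgt e) ≤ R from le_max_right _ _) hDE Finset.sdiff_disjoint
  have hA : ∀ y b, y ∉ D → b ∈ D → G.Adj y b → KSchA.Wt G ⟨cellGeomSG₂ G ψ P w₀ Λ, p, δc⟩ h e a a' du j o s(y, b) ≠ 0 →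
      b ∈ graphBall G w₀ (R₀ + 1) :=
    fun y b hy hb hadj hw => entrance_faceFresh₂ (S := ⟨cellGeomSG₂ G ψ P w₀ Λ, p, δc⟩) rfl hΛ hV hdu hlip hQ hρ hy hb hadj hw
  have hRg : Dd ⊆ D := fun u hu =>
    Finset.mem_sdiff.2 ⟨Win_farAS₂_subset_Efar P w₀ hlip hws (le_trans (by omega) (hΛ.ρE1 a' (tgt e) du 0)) j (hDd hu),
      Finset.disjoint_left.1 (disjoint_Win_farAS₂_Stub P w₀ a' (tgt e) du j _) (hDd hu)⟩
  have hDπ : ∀ v ∈ D, v ∈ graphBall G w₀ R := fun v hv =>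
    graphBall_mono G w₀ (le_max_left _ _) (mem_graphBall_of_mem_VWin (hDE' hv))
  have hroot : w₀ ∉ D := KSchA.root_not_mem_of_fresh (S := ⟨cellGeomSG₂ G ψ P w₀ Λ, p, δc⟩)
    (levelGeomSG₂ P w₀ hΛ hlip) (qSepGeomSG₂ P w₀ hlip) hV hdu (a := a) (hDE.trans Finset.subset_union_right)
  exact real_rim_le_of_radius hWD hDπ (fun e' he' => KSchA.Wt_eq_zero_of_not_mem_edgeSet he') hroot
    ((Finset.filter_subset _ _).trans hRg) (fun t ht => (Finset.mem_filter.1 ht).2) hA hR₁ hR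
    (Rw := Λ.rE a' (tgt e) du) (fun d hd => mem_graphBall_of_mem_VWin (hDE' hd)) fun d hd d' hd' => hdiam' d (hDE hd) d' (hDE hd')

end Skelφ

end Summit.CriticalPhenomena.PercolationContinuityZ3.Theorems.Transplant

end
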